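import Summits.ResolutionOfSingularities.ResolutionOfSingularities.Theorems.GaloisDescentLU
import Summits.ResolutionOfSingularities.ResolutionOfSingularities.Theorems.HenselKeyChainLU
import Mathlib.FieldTheory.Normal.Closure
import Mathlib.FieldTheory.SeparableDegree
import Mathlib.FieldTheory.IsAlgClosed.AlgebraicClosure
import HarnessLib

/-!
# GaloisDescentLU2 — the Galois Hensel-descent datum and THE LAW (decomp-res node «DescentLadder», lens-1 g23), tree companion 2/3

Content VERBATIM from PART B of the decomp-res lens-1 g23 node `HOME/decomp-res-lens-1/g23/DescentLadder.lean`
(HOME = run/shared/lean/pub/decomp-res; NODE-g23.md), re-namespaced `…Theorems.GaloisDescentLU` (one namespace across the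
three companion files `GaloisDescentLU`, `GaloisDescentLU2`, `GaloisDescentLU3`, split for the 400-line cap), typed against
the LANDED `Theorems.HenselKeyChainLU` (p803393), `Theorems.KeyChainLU` and `Literature…KrullRamificationHenselSubfields`;
nothing inlined; a pure addition (no existing file touched).  Landing target:
`Summits/ResolutionOfSingularities/ResolutionOfSingularities/Theorems/GaloisDescentLU2.lean`
(`--kind proof --supports stmt-ResolutionOfSingularities-0641`, HELPER file of the host route `Valuative`).

WINDOW g23 item (K-e) (CRITIC-LEDGER row 167): the COMING-DOWN LAW.  A place `(K, O)` over `k` carrying a GALOIS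
HENSEL-DESCENT DATUM — a finite Galois `K′ | K` whose group fixes a valuation ring `O′` above `O` (`G = G_Z`), a
`G`-stable upstairs frame `F′ ⊆ K′` with `F′ ∩ K = F₁` a finitely generated KEY-CHAIN sub-top of `K` (`K | F₁` finite
separable), and a henselian generator `K′ = F′(η′)` over `O′ ∩ F′` with residue in that of `F′` — is itself a HENSEL
TOP over `F₁` (`henselKeyChainTopBelow_of_galoisHenselDescent`, file 2), hence admits relative local uniformization
(`relLU_of_galoisHenselDescent`, via the landed g22 law `relLU_of_henselKeyChainTop`); the located residual is re-cut
accordingly (`nonKHToricArchLUKeyHensel_iff_descent`, `closes_descent`, file 3).  Hypothesis-free: no port, no `TheoremD`.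

THIS FILE (PART B): the typed cell `GaloisHenselDescentDatum k O` and the law
`henselKeyChainTopBelow_of_galoisHenselDescent : GaloisHenselDescentDatum k O → HenselKeyChainTopBelow k O` (transport
into `AlgebraicClosure K` with a valuation ring above `O′` — tree `exists_valuationSubring_comap_eq` — and the Galois
closure of `K′` over `F₁`, then PART A), `relLU_of_galoisHenselDescent`, `not_galoisHenselDescentDatum_of_not_hensel`.
-/

noncomputable section

open IntermediateField Polynomial Literature.AlgebraicGeometry.Resolution
open scoped Pointwise

namespace Summit.ResolutionOfSingularities.ResolutionOfSingularities.Theorems.GaloisDescentLU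

/-! ## PART B — the DESCENT CELL of a place `(K, O)` over `k` and THE LAW -/

section Law

open Summit.ResolutionOfSingularities.ResolutionOfSingularities.Theorems.KeyChainLU
open Summit.ResolutionOfSingularities.ResolutionOfSingularities.Theorems.HenselKeyChainLU

variable (k : Type) [Field k] {K : Type} [Field K] [Algebra k K]

/-- **The GALOIS HENSEL-DESCENT DATUM of a place `(K, O)` over `k`** (the cell `δ(K,O) < ∞` of the descent
ladder; TYPED, syntactic).  There are: a finitely generated key-chain sub-top `F₁ ⊆ K` with `K | F₁` finite
separable; a finite GALOIS extension `K′ | K` (inside an algebraic closure) with a valuation ring `O′` above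
`O` fixed by the whole Galois group (`G = G_Z`); a `G`-stable subfield `F′ ⊆ K′` (the upstairs FRAME) whose
elements lying in `K` are exactly those of `F₁` (`F′ ∩ K = F₁`); and a HENSELIAN GENERATOR of `K′` over `F′`:
`K′ = F′(η′)`, `η′ ∈ O′` with residue in that of `F′`, `f(η′) = 0`, `v′(f′(η′)) = 0` for an `f` with
coefficients in `O′ ∩ F′`.  Generic inhabitants: tame cyclic tops `K′ = K(θ)`, `θⁿ ∈ K`, `p ∤ n`, `μₙ ⊆ k`,
with `F′ = k(u′)` an eigen-frame ([CossartPiltant2019, Prop. 6.2]; tree `TameCyclicEigenparameters`) and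
Artin–Schreier tops `℘(ϑ) ∈ K` with `σ(ϑ) = ϑ + 1`; see NODE-g23.md §3 for a certified instance.
[KnafKuhlmann2009 = arXiv:math/0702856, Lemma 3.7] [CossartPiltant2019, Prop. 6.2] -/
def GaloisHenselDescentDatum (O : ValuationSubring K) : Prop :=
  ∃ F₁ : IntermediateField k K, F₁.FG ∧ KeyChainTopBelow k (O.comap (algebraMap F₁ K)) ∧
    FiniteDimensional F₁ K ∧ Algebra.IsSeparable F₁ K ∧
  ∃ K' : IntermediateField K (AlgebraicClosure K), FiniteDimensional K K' ∧ IsGalois K K' ∧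
  ∃ O' : ValuationSubring K', O'.comap (algebraMap K K') = O ∧
    (∀ g : K' ≃ₐ[K] K', ∀ x : K', x ∈ O' ↔ g x ∈ O') ∧
  ∃ F' : Subfield K', (∀ g : K' ≃ₐ[K] K', ∀ x ∈ F', g x ∈ F') ∧
    (∀ x : K, algebraMap K K' x ∈ F' ↔ x ∈ F₁) ∧
  ∃ η' : K', η' ∈ O' ∧ (∃ c ∈ F', η' - c ∈ O'.nonunits) ∧
    Subfield.closure ((F' : Set K') ∪ {η'}) = ⊤ ∧
  ∃ f : Polynomial K', (∀ i, f.coeff i ∈ O' ∧ f.coeff i ∈ F') ∧ f.eval η' = 0 ∧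
    O'.valuation ((Polynomial.derivative f).eval η') = 1

variable {k}

set_option maxHeartbeats 1600000 in
set_option synthInstance.maxHeartbeats 80000 in
/-- **THE LAW OF THE DESCENT LADDER (kernel, hypothesis-free): the Hensel datum comes down.**  A place
carrying a Galois Hensel-descent datum over the key-chain sub-top `F₁` is a Hensel top over the SAME `F₁`
(`δ < ∞ ⇒ δ = 1`).  Proof: realise everything inside `L = K̄` with a valuation ring `V` above `O′`
(`exists_valuationSubring_comap_eq`), pass to the Galois closure `N` of `K′` over `M = F₁` and apply the
ambient descent theorem `exists_henselRoot_of_galoisDescent`; pull the henselian generator back to `K`.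
[KnafKuhlmann2009 = arXiv:math/0702856, Lemma 3.7 (3)] [ZariskiSamuel1960, Ch. VI §7 Thm. 12 Cor. 3] -/
theorem henselKeyChainTopBelow_of_galoisHenselDescent (O : ValuationSubring K)
    (hD : GaloisHenselDescentDatum k O) : HenselKeyChainTopBelow k O := by
  classical
  obtain ⟨F₁, hfg, hkey, hfin, hsep, K', hfin', hgal, O', hO'O, hdec, F', hstab, hF'K, η', hη'O',
    hres, hgen, f, hcoef, hfη, hder⟩ := hD
  haveI := hfin; haveI := hsep; haveI := hfin'; haveI := hgal
  let L := AlgebraicClosure K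
  -- a valuation ring of `L` above `O′` (hence above `O`)
  obtain ⟨V, hV⟩ := exists_valuationSubring_comap_eq (Ω := L) O'
  have hVK : V.comap (algebraMap K L) = O := by
    rw [IsScalarTower.algebraMap_eq K K' L, ← ValuationSubring.comap_comap, hV, hO'O]
  have hmemO : ∀ x : K, x ∈ O ↔ algebraMap K L x ∈ V := fun x => by
    rw [← hVK, ValuationSubring.mem_comap]
  have hmemO' : ∀ x : K', x ∈ O' ↔ algebraMap K' L x ∈ V := fun x => by
    rw [← hV, ValuationSubring.mem_comap]
  -- the base subfield `M = F₁` read in `L`, and the `M`-algebra structures on `K`, `K′`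
  let M : Subfield L := (algebraMap F₁ L).fieldRange
  let e : F₁ ≃+* M := (algebraMap F₁ L).rangeRestrictFieldEquiv
  have he : ∀ z : F₁, ((e z : M) : L) = algebraMap K L (z : K) := fun z => by
    rw [RingHom.rangeRestrictFieldEquiv_apply_coe, IsScalarTower.algebraMap_apply F₁ K L]
    rfl
  have hF₁L : ∀ z : F₁, algebraMap F₁ L z = algebraMap K L (z : K) := fun z =>
    IsScalarTower.algebraMap_apply F₁ K L z
  letI algMK : Algebra M K := ((algebraMap F₁ K).comp e.symm.toRingHom).toAlgebra
  have hMK : ∀ c : M, algebraMap M K c = ((e.symm c : F₁) : K) := fun c => rfl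
  haveI tMKL : IsScalarTower M K L := IsScalarTower.of_algebraMap_eq fun c => by
    rw [hMK, ← he, RingEquiv.apply_symm_apply]
    rfl
  -- `Algebra M K'` is `IntermediateField.algebra'` (restriction of the `M`-action on `L`)
  haveI tMKK' : IsScalarTower M K K' := inferInstance
  haveI tMK'L : IsScalarTower M K' L := IsScalarTower.of_algebraMap_eq fun c => rfl
  have hecomp : (algebraMap M K).comp (e : F₁ →+* M) =
      ((RingEquiv.refl K : K ≃+* K) : K →+* K).comp (algebraMap F₁ K) := by
    ext z
    change algebraMap M K (e z) = (z : K)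
    rw [hMK, RingEquiv.symm_apply_apply]
  haveI : FiniteDimensional M K := Module.Finite.of_equiv_equiv e (RingEquiv.refl K) hecomp
  haveI : Algebra.IsSeparable M K := Algebra.IsSeparable.of_equiv_equiv e (RingEquiv.refl K) hecomp
  haveI : FiniteDimensional M K' := Module.Finite.trans K K'
  haveI : Algebra.IsSeparable M K' := Algebra.IsSeparable.trans M K K'
  haveI : IsAlgClosure M L := ⟨AlgebraicClosure.isAlgClosed K, Algebra.IsAlgebraic.trans M K L⟩
  -- the Galois closure `N` of `K′` over `M`
  let N : IntermediateField M L := normalClosure M K' L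
  haveI : FiniteDimensional M N := normalClosure.is_finiteDimensional M K' L
  haveI : Algebra.IsSeparable M N := by
    have h : ∀ g : K' →ₐ[M] L, Algebra.IsSeparable M g.fieldRange := fun g =>
      AlgEquiv.Algebra.isSeparable (AlgEquiv.ofInjectiveField g)
    show Algebra.IsSeparable M (normalClosure M K' L)
    rw [normalClosure_def]
    infer_instance
  haveI : IsGalois M N := isGalois_iff.mpr ⟨inferInstance, inferInstance⟩
  -- `K`, `K′`, `F′` read inside `N`
  let ιK : K →ₐ[M] L := IsScalarTower.toAlgHom M K L
  let ιK' : K' →ₐ[M] L := IsScalarTower.toAlgHom M K' L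
  have hιK : ∀ x : K, ιK x = algebraMap K L x := fun _ => rfl
  have hιK' : ∀ x : K', ιK' x = algebraMap K' L x := fun _ => rfl
  have hK'N : ιK'.fieldRange ≤ N := ιK'.fieldRange_le_normalClosure
  have hKK'L : ιK.fieldRange ≤ ιK'.fieldRange := by
    intro y hy
    obtain ⟨x, rfl⟩ := AlgHom.mem_fieldRange.mp hy
    exact AlgHom.mem_fieldRange.mpr ⟨algebraMap K K' x, (IsScalarTower.algebraMap_apply K K' L x).symm⟩
  have hKN : ιK.fieldRange ≤ N := hKK'L.trans hK'N
  have hMF' : ∀ c : M, algebraMap M L c ∈ F'.map (algebraMap K' L : K' →+* L) := fun c => by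
    obtain ⟨z, hz⟩ := RingHom.mem_fieldRange.mp c.2
    refine Subfield.mem_map.mpr ⟨algebraMap K K' z, (hF'K z).mpr z.2, ?_⟩
    rw [← IsScalarTower.algebraMap_apply K K' L, ← hF₁L, hz]
    rfl
  let F'L : IntermediateField M L := (F'.map (algebraMap K' L : K' →+* L)).toIntermediateField hMF'
  have hmF'L : ∀ y : L, y ∈ F'L ↔ ∃ z ∈ F', algebraMap K' L z = y := fun y => Subfield.mem_map
  have hF'K'L : F'L ≤ ιK'.fieldRange := by
    intro y hy
    obtain ⟨x, -, rfl⟩ := (hmF'L y).mp hy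
    exact AlgHom.mem_fieldRange.mpr ⟨x, rfl⟩
  have hF'N : F'L ≤ N := hF'K'L.trans hK'N
  let Kf : IntermediateField M N := IntermediateField.restrict hKN
  let K'f : IntermediateField M N := IntermediateField.restrict hK'N
  let F'f : IntermediateField M N := IntermediateField.restrict hF'N
  have hmKf : ∀ x : N, x ∈ Kf ↔ ∃ z : K, algebraMap K L z = (x : L) := fun x => by
    rw [IntermediateField.mem_restrict]; exact AlgHom.mem_fieldRange
  have hmK'f : ∀ x : N, x ∈ K'f ↔ ∃ z : K', algebraMap K' L z = (x : L) := fun x => by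
    rw [IntermediateField.mem_restrict]; exact AlgHom.mem_fieldRange
  have hmF'f : ∀ x : N, x ∈ F'f ↔ ∃ z ∈ F', algebraMap K' L z = (x : L) := fun x => by
    rw [IntermediateField.mem_restrict]; exact hmF'L x.1
  have hKK' : Kf ≤ K'f := fun x hx => by
    obtain ⟨z, hz⟩ := (hmKf x).mp hx
    exact (hmK'f x).mpr ⟨algebraMap K K' z, by rw [← IsScalarTower.algebraMap_apply K K' L, hz]⟩
  have hF'K' : F'f ≤ K'f := fun x hx => by
    obtain ⟨z, -, hz⟩ := (hmF'f x).mp hx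
    exact (hmK'f x).mpr ⟨z, hz⟩
  -- the embedding `ψ : K′ → N`
  let ψ : K' →ₐ[M] N := ιK'.codRestrict _ fun x => hK'N (AlgHom.mem_fieldRange.mpr ⟨x, rfl⟩)
  have hψ : ∀ x : K', ((ψ x : N) : L) = algebraMap K' L x := fun _ => rfl
  have hψK'f : ∀ x : K', ψ x ∈ K'f := fun x => (hmK'f _).mpr ⟨x, (hψ x).symm⟩
  have hK'f_eq : ∀ x : N, x ∈ K'f → ∃ z : K', ψ z = x := fun x hx => by
    obtain ⟨z, hz⟩ := (hmK'f x).mp hx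
    exact ⟨z, Subtype.ext (by rw [hψ, hz])⟩
  -- Galois elements fixing `K` restrict to `Gal(K′ | K)`
  have hlift : ∀ h : N ≃ₐ[M] N, h ∈ Kf.fixingSubgroup →
      ∃ g : K' ≃ₐ[K] K', ∀ x : K', algebraMap K' L (g x) = ((h (ψ x) : N) : L) := by
    intro h hh
    rw [IntermediateField.mem_fixingSubgroup_iff] at hh
    let χ : K' →ₐ[M] L := (N.val.comp (h : N →ₐ[M] N)).comp ψ
    have hχ : ∀ x : K', χ x = ((h (ψ x) : N) : L) := fun _ => rfl
    have hχK : ∀ z : K, χ (algebraMap K K' z) = algebraMap K L z := fun z => by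
      have hmem : ψ (algebraMap K K' z) ∈ Kf :=
        (hmKf _).mpr ⟨z, by rw [hψ, ← IsScalarTower.algebraMap_apply K K' L]⟩
      rw [hχ, hh _ hmem, hψ, ← IsScalarTower.algebraMap_apply K K' L]
    let φ : K' →ₐ[K] L := { χ.toRingHom with commutes' := hχK }
    have hφ : ∀ x : K', φ x = χ x := fun _ => rfl
    refine ⟨φ.restrictNormal' K', fun x => ?_⟩
    have h1 := AlgHom.restrictNormal_commutes φ K' x
    rw [Algebra.algebraMap_self, RingHom.id_apply] at h1
    rw [← hχ, ← hφ, ← h1]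
    rfl
  -- hypotheses of the ambient descent theorem
  have hdec' : ∀ h ∈ Kf.fixingSubgroup, ∀ x ∈ K'f, ((x : N) : L) ∈ V ↔ ((h x : N) : L) ∈ V := by
    intro h hh x hx
    obtain ⟨g, hg⟩ := hlift h hh
    obtain ⟨z, rfl⟩ := hK'f_eq x hx
    rw [hψ, ← hg z, ← hmemO', ← hmemO']
    exact hdec g z
  have hstab' : ∀ h ∈ Kf.fixingSubgroup, ∀ x ∈ F'f, h x ∈ F'f := by
    intro h hh x hx
    obtain ⟨g, hg⟩ := hlift h hh
    obtain ⟨z, hzF', hz⟩ := (hmF'f x).mp hx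
    have hxz : ψ z = x := Subtype.ext (by rw [hψ, hz])
    rw [← hxz]
    exact (hmF'f _).mpr ⟨g z, hstab g z hzF', hg z⟩
  have hinv' : ∀ x ∈ F'f, x ∈ Kf → x ∈ (⊥ : IntermediateField M N) := by
    intro x hxF hxK
    obtain ⟨z', hz'F', hz'⟩ := (hmF'f x).mp hxF
    obtain ⟨z, hz⟩ := (hmKf x).mp hxK
    have hzz' : z' = algebraMap K K' z := by
      apply (algebraMap K' L).injective
      rw [hz', ← IsScalarTower.algebraMap_apply K K' L, hz]
    have hzF₁ : z ∈ F₁ := (hF'K z).mp (hzz' ▸ hz'F')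
    rw [IntermediateField.mem_bot]
    refine ⟨⟨algebraMap K L z, RingHom.mem_fieldRange.mpr ⟨⟨z, hzF₁⟩, ?_⟩⟩, Subtype.ext ?_⟩
    · rw [IsScalarTower.algebraMap_apply F₁ K L]; rfl
    · change algebraMap K L z = (x : L)
      exact hz
  have hη'V : ((ψ η' : N) : L) ∈ V := by rw [hψ, ← hmemO']; exact hη'O'
  have hres' : ∃ c ∈ F'f, V.valuation (((ψ η' : N) : L) - c) < 1 := by
    obtain ⟨c, hcF', hc⟩ := hres
    refine ⟨ψ c, (hmF'f _).mpr ⟨c, hcF', (hψ c).symm⟩, ?_⟩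
    rw [hψ, hψ, ← map_sub, ← valuation_comap_lt_one_iff V (algebraMap K' L : K' →+* L), hV]
    exact (ValuationSubring.mem_nonunits_iff O').mp hc
  have hgen' : ∀ E : IntermediateField M N, F'f ≤ E → ψ η' ∈ E → K'f ≤ E := by
    intro E hFE hηE x hx
    obtain ⟨z, rfl⟩ := hK'f_eq x hx
    let E' : Subfield K' := E.toSubfield.comap (ψ : K' →+* N)
    have hle : Subfield.closure ((F' : Set K') ∪ {η'}) ≤ E' := by
      rw [Subfield.closure_le]
      rintro y (hy | hy)
      · exact hFE ((hmF'f _).mpr ⟨y, hy, (hψ y).symm⟩)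
      · rw [Set.mem_singleton_iff] at hy
        subst hy
        exact hηE
    exact hle (by rw [hgen]; exact Subfield.mem_top z)
  -- the polynomial `f` read in `N`
  have hflifts : f.map (algebraMap K' L : K' →+* L) ∈ Polynomial.lifts (algebraMap N L) := by
    rw [Polynomial.lifts_iff_coeff_lifts]
    intro i
    rw [Polynomial.coeff_map]
    exact ⟨ψ (f.coeff i), rfl⟩
  obtain ⟨fN, hfN⟩ := (Polynomial.mem_lifts _).mp hflifts
  have hfNcoeff : ∀ i, fN.coeff i = ψ (f.coeff i) := fun i => by
    apply (algebraMap N L).injective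
    have h1 := congrArg (fun q => Polynomial.coeff q i) hfN
    simp only [Polynomial.coeff_map] at h1
    rw [h1]
    rfl
  have hcoef' : ∀ i, ((fN.coeff i : N) : L) ∈ V ∧ fN.coeff i ∈ F'f := fun i => by
    rw [hfNcoeff, hψ, ← hmemO']
    exact ⟨(hcoef i).1, (hmF'f _).mpr ⟨f.coeff i, (hcoef i).2, (hψ _).symm⟩⟩
  have hevN : ∀ q : Polynomial N, ∀ x : N,
      algebraMap N L (q.eval x) = (q.map (algebraMap N L)).eval (x : L) := fun q x => by
    rw [Polynomial.eval_map, ← Polynomial.eval₂_hom]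
    rfl
  have hevK' : ∀ q : Polynomial K', ∀ x : K',
      algebraMap K' L (q.eval x) = (q.map (algebraMap K' L : K' →+* L)).eval (algebraMap K' L x) :=
    fun q x => by rw [Polynomial.eval_map, ← Polynomial.eval₂_hom]
  have hfη' : fN.eval (ψ η') = 0 := by
    apply (algebraMap N L).injective
    rw [hevN, hfN, map_zero]
    change (f.map (algebraMap K' L : K' →+* L)).eval (algebraMap K' L η') = 0
    rw [← hevK', hfη, map_zero]
  have hder' : V.valuation (((derivative fN).eval (ψ η') : N) : L) = 1 := by
    have h1 : (((derivative fN).eval (ψ η') : N) : L) = algebraMap K' L ((derivative f).eval η') := by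
      change algebraMap N L ((derivative fN).eval (ψ η')) = _
      rw [hevN, ← Polynomial.derivative_map, hfN, Polynomial.derivative_map, hevK']
      rfl
    rw [h1, ← valuation_comap_eq_one_iff V ((derivative f).eval η'), hV]
    exact hder
  -- DESCENT
  obtain ⟨η, hηV, ⟨F, hFmon, hFcoef, hFη, hFder⟩, hKf⟩ :=
    exists_henselRoot_of_galoisDescent V N hKK' hF'K' hdec' hstab' hinv' hη'V hres' hgen' fN hcoef'
      hfη' hder'
  -- pull the henselian generator back to `K`
  have hηKf : η ∈ Kf := by rw [hKf]; exact IntermediateField.mem_adjoin_simple_self M η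
  obtain ⟨z, hz⟩ := (hmKf η).mp hηKf
  have hzO : z ∈ O := by rw [hmemO, hz]; exact hηV
  have hFlifts : F ∈ Polynomial.lifts (algebraMap K L) := by
    rw [Polynomial.lifts_iff_coeff_lifts]
    intro i
    obtain ⟨w, hw⟩ := RingHom.mem_fieldRange.mp (hFcoef i).2
    exact ⟨(w : K), by rw [← hF₁L]; exact hw⟩
  obtain ⟨F₀, hF₀map, -, hF₀mon⟩ := Polynomial.lifts_and_degree_eq_and_monic hFlifts hFmon
  have hF₀coeffL : ∀ i, algebraMap K L (F₀.coeff i) = F.coeff i := fun i => by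
    rw [← hF₀map, Polynomial.coeff_map]
  have hF₀coef : ∀ i, F₀.coeff i ∈ O ∧ F₀.coeff i ∈ F₁.toSubfield := fun i => by
    refine ⟨(hmemO _).mpr (by rw [hF₀coeffL]; exact (hFcoef i).1), ?_⟩
    obtain ⟨w, hw⟩ := RingHom.mem_fieldRange.mp (hFcoef i).2
    have hwi : (w : K) = F₀.coeff i := by
      apply (algebraMap K L).injective
      rw [hF₀coeffL, ← hw, IsScalarTower.algebraMap_apply F₁ K L]
      rfl
    rw [IntermediateField.mem_toSubfield, ← hwi]
    exact w.2
  have hevK : ∀ q : Polynomial K, ∀ x : K,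
      algebraMap K L (q.eval x) = (q.map (algebraMap K L)).eval (algebraMap K L x) :=
    fun q x => by rw [Polynomial.eval_map, ← Polynomial.eval₂_hom]
  have hF₀z : F₀.eval z = 0 := by
    apply (algebraMap K L).injective
    rw [hevK, hF₀map, hz, hFη, map_zero]
  have hF₀der : O.valuation ((derivative F₀).eval z) = 1 := by
    rw [← hVK, valuation_comap_eq_one_iff V ((derivative F₀).eval z), hevK, ← Polynomial.derivative_map,
      hF₀map, hz]
    exact hFder
  -- generation `K = F₁(z)`
  let S₀ : Subfield K := Subfield.closure ((F₁.toSubfield : Set K) ∪ {z})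
  have hMS₀ : ∀ c : M, algebraMap M L c ∈ S₀.map (algebraMap K L) := fun c => by
    obtain ⟨w, hw⟩ := RingHom.mem_fieldRange.mp c.2
    refine Subfield.mem_map.mpr ⟨(w : K), Subfield.subset_closure (Set.mem_union_left _ w.2), ?_⟩
    rw [← hF₁L, hw]
    rfl
  let EL : IntermediateField M L := (S₀.map (algebraMap K L)).toIntermediateField hMS₀
  have hELN : EL ≤ N := by
    intro y hy
    obtain ⟨x, -, rfl⟩ := Subfield.mem_map.mp hy
    exact hKN (AlgHom.mem_fieldRange.mpr ⟨x, rfl⟩)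
  let E : IntermediateField M N := IntermediateField.restrict hELN
  have hηE : η ∈ E := by
    rw [IntermediateField.mem_restrict]
    change (η : L) ∈ S₀.map (algebraMap K L)
    exact Subfield.mem_map.mpr ⟨z, Subfield.subset_closure (Set.mem_union_right _ rfl), hz⟩
  have hKfE : Kf ≤ E := by
    rw [hKf]
    exact IntermediateField.adjoin_simple_le_iff.mpr hηE
  have hS₀ : S₀ = ⊤ := by
    rw [eq_top_iff]
    intro x _
    have hxN : algebraMap K L x ∈ N := hKN (AlgHom.mem_fieldRange.mpr ⟨x, rfl⟩)
    have hxKf : (⟨algebraMap K L x, hxN⟩ : N) ∈ Kf := (hmKf _).mpr ⟨x, rfl⟩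
    have hxE := hKfE hxKf
    rw [IntermediateField.mem_restrict] at hxE
    change algebraMap K L x ∈ S₀.map (algebraMap K L) at hxE
    obtain ⟨y, hy, hyx⟩ := Subfield.mem_map.mp hxE
    rwa [← (algebraMap K L).injective hyx]
  exact ⟨F₁, z, hfg, hkey, hzO, hS₀, F₀, hF₀mon, hF₀coef, hF₀z, hF₀der⟩

/-- **THE LAW, RelLU form** (`relLU_of_tameDescent` of the g23 window, in Galois generality): a place with a
Galois Hensel-descent datum admits relative local uniformization over `k` — descent law, then the g22 law
`relLU_of_henselKeyChainTop` (engine KK09 3.7 over the g21 key-chain law). [KnafKuhlmann2009, Lemma 3.7]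
[folklore] -/
theorem relLU_of_galoisHenselDescent {O : ValuationSubring K} (hD : GaloisHenselDescentDatum k O) :
    RelLocalUniformization k K O :=
  relLU_of_henselKeyChainTop (henselKeyChainTopBelow_of_galoisHenselDescent O hD)

/-- Rung `δ = 1 ⇒ ¬(δ < ∞)` contrapositive: OFF the Hensel cell there is NO Galois Hensel-descent datum —
the form consumed by the cut. [folklore] -/
theorem not_galoisHenselDescentDatum_of_not_hensel {O : ValuationSubring K}
    (h : ¬ HenselKeyChainTopBelow k O) : ¬ GaloisHenselDescentDatum k O :=
  fun hD => h (henselKeyChainTopBelow_of_galoisHenselDescent O hD)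

end Law

end Summit.ResolutionOfSingularities.ResolutionOfSingularities.Theorems.GaloisDescentLU

end
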